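import Summits.CriticalPhenomena.PercolationContinuityZ3.Theorems.Transplant.SkelPhiNegReachHoldsAF
import Summits.CriticalPhenomena.PercolationContinuityZ3.Theorems.Transplant.SkelNegBParamsResidualsAK
import HarnessLib

/-!
# N1 (C) column at the slot-ledger (ζ′) **v3** tuple (κ-dependent bridge index): `reachHoldsRHNOFnL_negChoiceAllOTA_RFK`

One line over the slot-robust corollary `reachHoldsRHNOFnL_negChoiceAllOTA_of_exA_le` (SkelPhiNegReachHoldsAF, p324720): the (C) hypothesis of
`samePDropOfSkeletonNeg₁_of_choiceFnNOWL` at the v3 values `gv := KS.gT 0 KS.gxAK`, `fv := KS.fT 0 KS.fxA`, `Pv := KS.PR 0 Px`, `Sv := SUA NegB.exAFK mx`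
(stmt-g17 `SkelNegBParamsResidualsAK`: `cK κ = 1000·Kq κ + 1` INSIDE the K-slots `gxAK/PxFK/exAFK`; ∀-form server `NegB.Hle_exAFK : exA ≤ exAFK` pointwise).
Triggered by the refuter's located item 2026-08-22T09:17:13Z (the y′-face clearance `hc : NrF′ + 1 ≤ c` forces a κ-dependent bridge index;
design-owner ruling p3-g12 09:38:09Z; slot ledger (ζ′) v3, stmt-g17 10:03:06Z).  Nothing else in the (C) column changes.
builds on p205010 (kernel theorem, internal audit signed; external expert review pending). Nothing about the node is claimed.
Lane `prim-bschramm-*`, seat `prim-bschramm-p5` (gen 12; the (C) column is authored by the p5 lineage — DISCLOSED; counter-signature by a seat outside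
the lineage per V112 (6)); helper file (`--supports stmt-CriticalPhenomena-4575 --as helper`).
[cite: KozmaNitzan2024, §4 Theorem 6 (pp. 25–31); §1 p. 2 (approach 1)] [cite: BenjaminiSchramm1996, Conj. 4]
-/

noncomputable section

open scoped Classical

namespace Summit.CriticalPhenomena.PercolationContinuityZ3.Theorems.Transplant

namespace PlanarSkeletonNeg

/-- **THE (C) HYPOTHESIS OF THE NODE AT THE SLOT-LEDGER (ζ′) v3 VALUES** (`Px`, `mx` binders; no bridge-index binder — it lives inside the K-slots).
[cite: KozmaNitzan2024, §4 Theorem 6 (pp. 25–31)] -/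
theorem reachHoldsRHNOFnL_negChoiceAllOTA_RFK (Px : NegB.PSlot) (mx : NegB.GSlot) :
    ReachHoldsRHNOFnL NegB.LfA
      (negChoiceAllOTA (NegB.KS.gT 0 NegB.KS.gxAK) (NegB.KS.fT 0 NegB.KS.fxA) (NegB.KS.PR 0 Px) (NegB.SUA NegB.exAFK mx)) :=
  reachHoldsRHNOFnL_negChoiceAllOTA_of_exA_le NegB.KS.gxAK NegB.KS.fxA Px NegB.exAFK mx NegB.Hle_exAFK

end PlanarSkeletonNeg

end Summit.CriticalPhenomena.PercolationContinuityZ3.Theorems.Transplant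

end
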